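import Mathlib
import Summits.Ventures.PercRepro0.HarrisCyl

/-!
# P7 · HARRIS–FKG, part 2: approximation of measurable events by finitely determined events
(seat p3; Lemma 7.3 of proofs/P7-fkg-p3-v1.md)

* `DeterminedBy J C` — the event `C` depends only on the coordinates in the finite set `J`
  (a cylinder event over `J`); closed under complements and finite unions, and
  `sect_determined`: its sections along a pattern on `J` are `∅` or `univ`;
* `set_eq_generateFrom` — the product σ-algebra of `Set ι` is generated by the coordinate events
  `{ω | (e ∈ ω) ∈ S}`;
* `real_mem_eq_zero` — a coordinate outside `u` is closed a.s. under `setBernoulli u p`;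
* `exists_determinedBy_symmDiff_lt` — Lemma 7.3: for every measurable `A` and `ε > 0` there is a
  measurable `C` determined by a finite `J ⊆ u` with `P(A ∆ C) < ε` (induction on the generated
  σ-algebra: coordinate events, complements, countable unions via continuity from below).

Continued in `Harris.lean` (Theorem 7.5, `P7_FKG_holds`).
-/

namespace Summit.Ventures.PercRepro0.Harris

open MeasureTheory ProbabilityTheory unitInterval Set Defs
open scoped ENNReal NNReal symmDiff

variable {ι : Type*}

/-! ## Lemma 7.3: approximation of measurable events by finitely determined events -/

section Approx

variable (u : Set ι) (p : I)

/-- `C` depends only on the coordinates in `J` (a cylinder event over `J`). -/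
def DeterminedBy (J : Finset ι) (C : Set (Set ι)) : Prop :=
  ∀ ω ω' : Set ι, (∀ e ∈ J, (e ∈ ω ↔ e ∈ ω')) → (ω ∈ C ↔ ω' ∈ C)

/-- Enlarging the coordinate set preserves determinedness. -/
theorem DeterminedBy.mono {J J' : Finset ι} (h : J ⊆ J') {C : Set (Set ι)}
    (hC : DeterminedBy J C) : DeterminedBy J' C :=
  fun ω ω' hωω' => hC ω ω' fun e he => hωω' e (h he)

/-- Complements of determined events are determined. -/
theorem DeterminedBy.compl {J : Finset ι} {C : Set (Set ι)} (hC : DeterminedBy J C) :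
    DeterminedBy J Cᶜ :=
  fun ω ω' h => not_congr (hC ω ω' h)

/-- `∅` is determined by any coordinate set. -/
theorem DeterminedBy.empty (J : Finset ι) : DeterminedBy J (∅ : Set (Set ι)) :=
  fun _ _ _ => Iff.rfl

/-- `univ` is determined by any coordinate set. -/
theorem DeterminedBy.univ (J : Finset ι) : DeterminedBy J (univ : Set (Set ι)) :=
  fun _ _ _ => Iff.rfl

/-- A finite union of determined events is determined by the union of the coordinate sets. -/
theorem DeterminedBy.biUnion [DecidableEq ι] {s : Finset ℕ} {J : ℕ → Finset ι}
    {C : ℕ → Set (Set ι)} (hC : ∀ n ∈ s, DeterminedBy (J n) (C n)) :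
    DeterminedBy (s.biUnion J) (⋃ n ∈ s, C n) := by
  intro ω ω' h
  simp only [mem_iUnion]
  refine exists_congr fun n => exists_congr fun hn => hC n hn ω ω' fun e he => ?_
  exact h e (Finset.mem_biUnion.2 ⟨n, hn, he⟩)

/-- The section of an event determined by `J` along a pattern on `J` is `∅` or `univ`. -/
theorem sect_determined (J : Finset ι) (η : J → Bool) {C : Set (Set ι)} (hC : DeterminedBy J C)
    (ω ω' : Set ι) : ω ∈ sect J η C ↔ ω' ∈ sect J η C :=
  hC _ _ fun e he => by rw [mem_patch_of_mem J he, mem_patch_of_mem J he]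

/-- The product σ-algebra of `Set ι` is generated by the coordinate events `{ω | (e ∈ ω) ∈ S}`. -/
theorem set_eq_generateFrom :
    (Set.instMeasurableSpace : MeasurableSpace (Set ι)) =
      MeasurableSpace.generateFrom
        {B | ∃ (e : ι) (S : Set Prop), (fun ω : Set ι => e ∈ ω) ⁻¹' S = B} := by
  refine le_antisymm ?_ (MeasurableSpace.generateFrom_le ?_)
  · refine iSup_le fun e => ?_
    exact MeasurableSpace.comap_le_iff_le_map.2 fun S _ =>
      MeasurableSpace.measurableSet_generateFrom ⟨e, S, rfl⟩
  · rintro B ⟨e, S, rfl⟩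
    exact (measurable_set_mem e) MeasurableSet.of_discrete

/-- A coordinate outside `u` is closed a.s.: `P{ω | e ∈ ω} = 0` for `e ∉ u`. -/
theorem real_mem_eq_zero {e : ι} (he : e ∉ u) : (setBernoulli u p).real {ω : Set ι | e ∈ ω} = 0 := by
  have h : {ω : Set ι | e ∈ ω} = {ω : Set ι | ∀ e' ∈ ({e} : Finset ι), (e' ∈ ω) ∈ {q : Prop | q}} := by
    ext ω; simp
  rw [measureReal_def, h, setBernoulli_pi, Finset.prod_singleton]
  simp [he]

/-- Lemma 7.3: every measurable event is approximated in measure, to any precision, by a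
measurable event determined by a finite set of coordinates inside `u`. -/
theorem exists_determinedBy_symmDiff_lt {A : Set (Set ι)} (hA : MeasurableSet A) {ε : ℝ}
    (hε : 0 < ε) :
    ∃ J : Finset ι, ↑J ⊆ u ∧ ∃ C : Set (Set ι), DeterminedBy J C ∧ MeasurableSet C ∧
      (setBernoulli u p).real (A ∆ C) < ε := by
  classical
  set μ := setBernoulli u p with hμ
  -- the class of approximable events
  let Q : Set (Set ι) → Prop := fun A => ∀ ε : ℝ, 0 < ε → ∃ J : Finset ι, ↑J ⊆ u ∧
    ∃ C : Set (Set ι), DeterminedBy J C ∧ MeasurableSet C ∧ μ.real (A ∆ C) < ε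
  suffices hQ : Q A from hQ ε hε
  have hgen := set_eq_generateFrom (ι := ι)
  have hA' : MeasurableSet[MeasurableSpace.generateFrom
      {B | ∃ (e : ι) (S : Set Prop), (fun ω : Set ι => e ∈ ω) ⁻¹' S = B}] A := by
    rw [← hgen]; exact hA
  refine MeasurableSpace.generateFrom_induction _ (fun s _ => Q s) ?_ ?_ ?_ ?_ A hA'
  · -- coordinate events
    rintro B ⟨e, S, rfl⟩ _ ε hε
    by_cases hu : e ∈ u
    · refine ⟨{e}, by simpa using hu, (fun ω : Set ι => e ∈ ω) ⁻¹' S, ?_,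
        (measurable_set_mem e) MeasurableSet.of_discrete, ?_⟩
      · intro ω ω' h
        have h' : e ∈ ω ↔ e ∈ ω' := h e (Finset.mem_singleton_self e)
        simp only [mem_preimage]
        rw [propext h']
      · rw [symmDiff_self]
        simpa using hε
    · have hnull : μ.real {ω : Set ι | e ∈ ω} = 0 := real_mem_eq_zero u p hu
      by_cases hF : False ∈ S
      · refine ⟨∅, by simp, univ, DeterminedBy.univ ∅, MeasurableSet.univ, ?_⟩
        have hsd : ((fun ω : Set ι => e ∈ ω) ⁻¹' S) ∆ univ = ((fun ω : Set ι => e ∈ ω) ⁻¹' S)ᶜ :=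
          symmDiff_top _
        rw [hsd]
        refine lt_of_le_of_lt (le_of_eq (measureReal_mono_null ?_ hnull)) hε
        intro ω hω
        by_contra hne
        have : (e ∈ ω) = False := eq_false hne
        exact hω (by rw [mem_preimage, this]; exact hF)
      · refine ⟨∅, by simp, ∅, DeterminedBy.empty ∅, MeasurableSet.empty, ?_⟩
        have hsd : ((fun ω : Set ι => e ∈ ω) ⁻¹' S) ∆ ∅ = (fun ω : Set ι => e ∈ ω) ⁻¹' S :=
          symmDiff_bot _
        rw [hsd]
        refine lt_of_le_of_lt (le_of_eq (measureReal_mono_null ?_ hnull)) hε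
        intro ω hω
        by_contra hne
        have : (e ∈ ω) = False := eq_false hne
        rw [mem_preimage, this] at hω
        exact hF hω
  · -- empty
    intro ε hε
    exact ⟨∅, by simp, ∅, DeterminedBy.empty ∅, MeasurableSet.empty, by simpa using hε⟩
  · -- complements
    intro t _ ht ε hε
    obtain ⟨J, hJ, C, hC, hCm, hlt⟩ := ht ε hε
    exact ⟨J, hJ, Cᶜ, hC.compl, hCm.compl, by rwa [compl_symmDiff_compl]⟩
  · -- countable unions
    intro s hs ih ε hε
    have hsm : ∀ n, MeasurableSet (s n) := fun n => by rw [hgen]; exact hs n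
    have hsU : MeasurableSet (⋃ n, s n) := MeasurableSet.iUnion hsm
    -- continuity from below: a finite initial segment carries almost all the mass
    have htend : Filter.Tendsto (fun N => μ.real (Set.accumulate s N)) Filter.atTop
        (nhds (μ.real (⋃ n, s n))) :=
      (ENNReal.tendsto_toReal (measure_ne_top μ _)).comp tendsto_measure_iUnion_accumulate
    obtain ⟨N, hN⟩ := (htend.eventually (lt_mem_nhds
      (show μ.real (⋃ n, s n) - ε / 2 < μ.real (⋃ n, s n) by linarith))).exists
    have hacc : Set.accumulate s N = ⋃ n ∈ Finset.range (N + 1), s n := by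
      rw [Set.accumulate_eq_biInter_lt]
      ext ω
      simp [Finset.mem_range]
    have haccm : MeasurableSet (Set.accumulate s N) := by
      rw [hacc]; exact Finset.measurableSet_biUnion _ fun n _ => hsm n
    have htail : μ.real ((⋃ n, s n) \ Set.accumulate s N) < ε / 2 :=
      measureReal_sdiff_lt_of_lt_add haccm (Set.accumulate_subset_iUnion N) (ε / 2) (by linarith)
    -- approximate the first `N + 1` events
    have hpos : 0 < ε / (2 * (N + 1)) := by positivity
    choose J hJ C hC hCm hlt using fun n => ih n (ε / (2 * (N + 1))) hpos
    refine ⟨(Finset.range (N + 1)).biUnion J, ?_, ⋃ n ∈ Finset.range (N + 1), C n,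
      DeterminedBy.biUnion fun n _ => hC n, Finset.measurableSet_biUnion _ fun n _ => hCm n, ?_⟩
    · rw [Finset.coe_biUnion]
      exact iUnion₂_subset fun n _ => hJ n
    · -- the symmetric difference is inside the tail plus the finite symmetric differences
      have hsub : (⋃ n, s n) ∆ (⋃ n ∈ Finset.range (N + 1), C n) ⊆
          ((⋃ n, s n) \ Set.accumulate s N) ∪ ⋃ n ∈ Finset.range (N + 1), (s n ∆ C n) := by
        intro ω hω
        rcases Set.mem_symmDiff.1 hω with ⟨h1, h2⟩ | ⟨h1, h2⟩
        · by_cases hacc' : ω ∈ Set.accumulate s N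
          · refine Or.inr ?_
            rw [hacc] at hacc'
            obtain ⟨n, hn, hωn⟩ := Set.mem_iUnion₂.1 hacc'
            refine Set.mem_iUnion₂.2 ⟨n, hn, Set.mem_symmDiff.2 (Or.inl ⟨hωn, fun hc => h2 ?_⟩)⟩
            exact Set.mem_iUnion₂.2 ⟨n, hn, hc⟩
          · exact Or.inl ⟨h1, hacc'⟩
        · refine Or.inr ?_
          obtain ⟨n, hn, hωn⟩ := Set.mem_iUnion₂.1 h1
          refine Set.mem_iUnion₂.2 ⟨n, hn, Set.mem_symmDiff.2 (Or.inr ⟨hωn, fun hc => h2 ?_⟩)⟩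
          exact Set.mem_iUnion.2 ⟨n, hc⟩
      have hfin : μ.real (⋃ n ∈ Finset.range (N + 1), (s n ∆ C n)) < ε / 2 := by
        refine lt_of_le_of_lt (measureReal_biUnion_finset_le _ _) ?_
        calc ∑ n ∈ Finset.range (N + 1), μ.real (s n ∆ C n)
            < ∑ _n ∈ Finset.range (N + 1), ε / (2 * (N + 1)) :=
              Finset.sum_lt_sum_of_nonempty ⟨0, Finset.mem_range.2 (Nat.succ_pos N)⟩
                fun n _ => hlt n
          _ = ε / 2 := by
              rw [Finset.sum_const, Finset.card_range, nsmul_eq_mul, Nat.cast_succ]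
              field_simp
      calc μ.real ((⋃ n, s n) ∆ (⋃ n ∈ Finset.range (N + 1), C n))
          ≤ μ.real (((⋃ n, s n) \ Set.accumulate s N) ∪
              ⋃ n ∈ Finset.range (N + 1), (s n ∆ C n)) := measureReal_mono hsub
        _ ≤ μ.real ((⋃ n, s n) \ Set.accumulate s N) +
              μ.real (⋃ n ∈ Finset.range (N + 1), (s n ∆ C n)) := measureReal_union_le _ _
        _ < ε / 2 + ε / 2 := add_lt_add htail hfin
        _ = ε := by ring

end Approx

end Summit.Ventures.PercRepro0.Harris
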